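import Summits.RiemannHypothesis.RiemannHypothesis.Theorems.WindowTraceArch.Negative.LocalWeyl
import HarnessLib

/-!
# `WindowStep`, line `christoffel-margin` — stub `stub_upperLawUniform`

Support file for the crux `stmt-RiemannHypothesis-14659`
(`Summit.RiemannHypothesis.RiemannHypothesis.Theses.SpectralTrace.WindowStep`), line
`christoffel-margin`: the UPPER local Weyl law for real families reproducing the Weil functional on
the Weil tests supported in a window `[-A, A]`, with the constant `C = C(A)` quantified BEFORE the
family,

* `stub_upperLawUniform` : `∀ A > 0, ∃ C > 0, ∀ ι γ, (γ reproduces W on [-A, A]) →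
  ∀ T s, (∀ i ∈ s, |γ_i - T| ≤ 1) → #s ≤ C (1 + log(1 + |T|))`.

This is `card_near_le_log_of_windowTrace` (`WindowTraceArch/Negative/LocalWeyl.lean`) with `∃ C`
hoisted in front of `∀ ι γ`. The proof there builds, from `A` alone, the half-width
`δ = min (A/2) (min (log 2/2) (1/2))`, a narrow bump `w` with `|ŵ(1/2+iv)|² ≥ c > 0` on `|v| ≤ 1`
(`exists_bump_lower`), and the constants `L = ‖w‖_{L¹,1/2}`, `P = ∫ |ŵ(1/2+iv)|² dv`,
`K = ∫ |ŵ(1/2+iv)|² (5 + log(1+|v|)) dv`, `C = (2L² + K + P + 1)/c` — none of which mentions the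
family — and only then, for a family `γ`, a height `T` and a finset `s` of indices within distance
`1` of `T`, bounds `#s · c ≤ Σ_{i ∈ s} |ŵ_T(1/2+iγ_i)|² ≤ Re Q(w_T) = weilArchQuadratic w_T ≤
2L² + K + P log(1+|T|)` (modulation `w_T(t) = e^{-iTt} w(t)`, `weilMellin_modulate`,
`weilMellin_weilConv_weilReflect_half`, `weilQuadratic_re_eq_weilArchQuadratic`,
`reDigammaQuarter_le_log`). So the same proof goes through verbatim once the constants are
introduced before the family; we repeat it here in that order (Lean cannot see through the `∃` of
the landed statement). A curried corollary `card_near_le_log_uniform` is recorded for convenience.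
-/

set_option linter.dupNamespace false

noncomputable section

open Complex Set MeasureTheory Filter
open scoped Real Topology ContDiff ComplexConjugate

namespace Summit.RiemannHypothesis.RiemannHypothesis.Theorems.SpectralTraceWindowStep

open Literature.NumberTheory.LFunctions
open Literature.Analysis.SpecialFunctions
open Summit.RiemannHypothesis.RiemannHypothesis.Theorems.WindowTraceArch.Negative

set_option maxHeartbeats 400000 in
/-- **stub_upperLawUniform — the upper local Weyl law, constant uniform in the family (RH-free).**
For every `A > 0` there is `C > 0` such that EVERY real family `γ` reproducing the Weil functional
`W` on the Weil tests supported in `[-A, A]` has at most `C (1 + log(1+|T|))` indices in any unit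
window `[T-1, T+1]`. This is `card_near_le_log_of_windowTrace` with `∃ C` moved in front of the
family: the constant `C = (2L² + K + P + 1)/c` is built from the narrow bump
`exists_bump_lower (min (A/2) (min (log 2/2) (1/2)))` alone; each index in `[T-1, T+1]` costs at
least `c` (`weilMellin_modulate`), the total cost is at most `Re Q(w_T)`
(`weilMellin_weilConv_weilReflect_half`, `sum_le_hasSum`), and
`Re Q(w_T) = weilArchQuadratic w_T ≤ 2L² + K + P log(1+|T|)`
(`weilQuadratic_re_eq_weilArchQuadratic`, `reDigammaQuarter_le_log`). [folklore] -/
theorem stub_upperLawUniform :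
    ∀ A : ℝ, 0 < A → ∃ C : ℝ, 0 < C ∧
      ∀ (ι : Type) (γ : ι → ℝ),
        (∀ g : ℝ → ℂ, Literature.NumberTheory.LFunctions.IsWeilTest g →
          tsupport g ⊆ Set.Icc (-A) A →
            HasSum (fun i => Literature.NumberTheory.LFunctions.weilMellin g (1 / 2 + (γ i : ℂ) * Complex.I))
              (Literature.NumberTheory.LFunctions.weilFunctional g)) →
        ∀ (T : ℝ) (s : Finset ι), (∀ i ∈ s, |γ i - T| ≤ 1) →
          (s.card : ℝ) ≤ C * (1 + Real.log (1 + |T|)) := by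
  intro A hA
  -- the bump (depends on `A` only)
  set δ : ℝ := min (A / 2) (min (Real.log 2 / 2) (1 / 2)) with hδ_def
  have hlog2 : 0 < Real.log 2 := Real.log_pos one_lt_two
  have hδ : 0 < δ := lt_min (half_pos hA) (lt_min (half_pos hlog2) one_half_pos)
  have hδA : δ ≤ A / 2 := min_le_left _ _
  have hδl : δ ≤ Real.log 2 / 2 := (min_le_right _ _).trans (min_le_left _ _)
  have hδ1 : δ ≤ 1 / 2 := (min_le_right _ _).trans (min_le_right _ _)
  obtain ⟨w, hw, hws, hw1, c, hc, hlow⟩ := exists_bump_lower hδ hδ1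
  -- constants (depend on the bump only)
  set L : ℝ := weilL1 w with hL
  have hL0 : 0 ≤ L := weilL1_nonneg w
  set P : ℝ := ∫ v : ℝ, ‖weilMellin w (1 / 2 + v * I)‖ ^ 2 with hP
  have hP0 : 0 ≤ P := integral_nonneg fun _ => by positivity
  set K : ℝ := ∫ v : ℝ, ‖weilMellin w (1 / 2 + v * I)‖ ^ 2 * (5 + Real.log (1 + |v|)) with hK
  have hK0 : 0 ≤ K := integral_nonneg fun v => by
    have : 0 ≤ Real.log (1 + |v|) := Real.log_nonneg (by linarith [abs_nonneg v])
    positivity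
  refine ⟨(2 * L ^ 2 + K + P + 1) / c, by positivity, fun ι γ h T s hs => ?_⟩
  -- the modulated test
  set wT : ℝ → ℂ := fun t => cexp (-((T * t : ℝ) : ℂ) * I) * w t with hwT_def
  have hwT : IsWeilTest wT := isWeilTest_modulate hw T
  have hwTs : tsupport wT ⊆ Icc (-δ) δ := (tsupport_modulate_subset w T).trans hws
  have hwTsA : tsupport wT ⊆ Icc (-(A / 2)) (A / 2) :=
    hwTs.trans (Icc_subset_Icc (by linarith) hδA)
  have hwTsl : tsupport wT ⊆ Icc (-(Real.log 2 / 2)) (Real.log 2 / 2) :=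
    hwTs.trans (Icc_subset_Icc (by linarith) hδl)
  -- (1) lower bound: each point near `T` costs `c`
  have hcount : (s.card : ℝ) * c ≤ ∑ i ∈ s, ‖weilMellin wT (1 / 2 + (γ i : ℂ) * I)‖ ^ 2 := by
    have : ∑ _i ∈ s, c ≤ ∑ i ∈ s, ‖weilMellin wT (1 / 2 + (γ i : ℂ) * I)‖ ^ 2 := by
      refine Finset.sum_le_sum fun i hi => ?_
      have e : weilMellin wT (1 / 2 + (γ i : ℂ) * I) =
          weilMellin w (1 / 2 + ((γ i - T : ℝ) : ℂ) * I) := weilMellin_modulate w T (γ i)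
      rw [e]
      exact hlow (γ i - T) (hs i hi)
    rwa [Finset.sum_const, nsmul_eq_mul] at this
  -- (2) the sum is bounded by `Re Q(w_T)`
  have hsum : ∑ i ∈ s, ‖weilMellin wT (1 / 2 + (γ i : ℂ) * I)‖ ^ 2 ≤ (weilQuadratic wT).re := by
    have hk : IsWeilTest (weilConv wT (weilReflect wT)) := hwT.weilConv hwT.weilReflect
    have hks : tsupport (weilConv wT (weilReflect wT)) ⊆ Icc (-A) A :=
      (tsupport_weilConv_weilReflect_subset hwT.2 hwTsA).trans
        (Icc_subset_Icc (by linarith) (by linarith))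
    have hsumC : HasSum (fun i => (((‖weilMellin wT (1 / 2 + (γ i : ℂ) * I)‖ ^ 2 : ℝ) : ℂ)))
        (weilFunctional (weilConv wT (weilReflect wT))) := by
      simpa only [weilMellin_weilConv_weilReflect_half hwT] using h _ hk hks
    have hsumR : HasSum (fun i => ‖weilMellin wT (1 / 2 + (γ i : ℂ) * I)‖ ^ 2)
        (weilFunctional (weilConv wT (weilReflect wT))).re := by
      simpa only [Complex.reCLM_apply, Complex.ofReal_re] using hsumC.mapL Complex.reCLM
    unfold weilQuadratic
    exact sum_le_hasSum s (fun _ _ => by positivity) hsumR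
  -- (3) `Re Q(w_T)` in Yoshida's analytic form, bounded term by term
  have hQ : (weilQuadratic wT).re = weilArchQuadratic wT :=
    weilQuadratic_re_eq_weilArchQuadratic hwT hwTsl
  -- (3a) polar part
  have hLT : weilL1 wT = L := by
    rw [hL, weilL1, weilL1]
    refine integral_congr_ae (Eventually.of_forall fun t => ?_)
    simp only [hwT_def, norm_modulate]
  have hpol : 2 * (weilMellin wT 0 * conj (weilMellin wT 1)).re ≤ 2 * L ^ 2 := by
    have h0 : ‖weilMellin wT 0‖ ≤ L := by
      rw [← hLT]; exact norm_weilMellin_le_weilL1 hwT.1.continuous hwT.2 (by simp) (by simp)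
    have h1 : ‖weilMellin wT 1‖ ≤ L := by
      rw [← hLT]; exact norm_weilMellin_le_weilL1 hwT.1.continuous hwT.2 (by simp) (by simp)
    have h2 : (weilMellin wT 0 * conj (weilMellin wT 1)).re ≤
        ‖weilMellin wT 0‖ * ‖weilMellin wT 1‖ := by
      refine (Complex.re_le_norm _).trans ?_
      rw [norm_mul, Complex.norm_conj]
    nlinarith [norm_nonneg (weilMellin wT 0), norm_nonneg (weilMellin wT 1)]
  -- (3b) the `L²` part is non-positive
  have hN : 0 ≤ Real.log π * ∫ t, ‖wT t‖ ^ 2 :=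
    mul_nonneg (Real.log_nonneg (by linarith [Real.pi_gt_three]))
      (integral_nonneg fun _ => by positivity)
  -- (3c) the archimedean integral
  have hF : ∀ v : ℝ, |5 + Real.log (1 + |v|) + Real.log (1 + |T|)| ≤
      (6 + Real.log (1 + |T|)) + (1 / 2) * v ^ 2 := by
    intro v
    have h1 : 0 ≤ Real.log (1 + |v|) := Real.log_nonneg (by linarith [abs_nonneg v])
    have h2 : 0 ≤ Real.log (1 + |T|) := Real.log_nonneg (by linarith [abs_nonneg T])
    have h3 : Real.log (1 + |v|) ≤ |v| := by
      have := Real.log_le_sub_one_of_pos (by linarith [abs_nonneg v] : (0 : ℝ) < 1 + |v|)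
      linarith
    rw [abs_of_nonneg (by linarith)]
    nlinarith [sq_nonneg (|v| - 1), sq_abs v]
  have hint0 : Integrable fun v : ℝ => ‖weilMellin w (1 / 2 + v * I)‖ ^ 2 *
      (5 + Real.log (1 + |v|) + Real.log (1 + |T|)) := by
    refine integrable_norm_sq_weilMellin_mul hw (by fun_prop) (by
      linarith [Real.log_nonneg (by linarith [abs_nonneg T] : (1 : ℝ) ≤ 1 + |T|)])
      (by norm_num) hF
  have hint1 : Integrable fun u : ℝ => ‖weilMellin w (1 / 2 + ((u - T : ℝ) : ℂ) * I)‖ ^ 2 *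
      (5 + Real.log (1 + |u - T|) + Real.log (1 + |T|)) := by
    have := hint0.comp_sub_right T
    exact this
  have harch : ∫ u : ℝ, ‖weilMellin wT (1 / 2 + u * I)‖ ^ 2 *
        (Complex.digamma (1 / 4 + u / 2 * I)).re ≤ K + Real.log (1 + |T|) * P := by
    calc ∫ u : ℝ, ‖weilMellin wT (1 / 2 + u * I)‖ ^ 2 * (Complex.digamma (1 / 4 + u / 2 * I)).re
        ≤ ∫ u : ℝ, ‖weilMellin w (1 / 2 + ((u - T : ℝ) : ℂ) * I)‖ ^ 2 *
            (5 + Real.log (1 + |u - T|) + Real.log (1 + |T|)) := by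
          refine integral_mono (integrable_norm_sq_weilMellin_mul_reDigammaQuarter hwT) hint1
            fun u => ?_
          simp only
          rw [weilMellin_modulate w T u]
          refine mul_le_mul_of_nonneg_left ?_ (by positivity)
          have h1 := reDigammaQuarter_le_log u
          have h2 : Real.log (1 + |u|) ≤ Real.log (1 + |u - T|) + Real.log (1 + |T|) := by
            rw [← Real.log_mul (by positivity) (by positivity)]
            refine Real.log_le_log (by positivity) ?_
            have : |u| ≤ |u - T| + |T| := by
              simpa using abs_add_le (u - T) T
            nlinarith [abs_nonneg (u - T), abs_nonneg T]
          change reDigammaQuarter u ≤ _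
          linarith
      _ = ∫ v : ℝ, ‖weilMellin w (1 / 2 + v * I)‖ ^ 2 *
            (5 + Real.log (1 + |v|) + Real.log (1 + |T|)) := by
          have := integral_sub_right_eq_self (μ := (volume : Measure ℝ))
            (fun v : ℝ => ‖weilMellin w (1 / 2 + v * I)‖ ^ 2 *
              (5 + Real.log (1 + |v|) + Real.log (1 + |T|))) T
          simpa using this
      _ = K + Real.log (1 + |T|) * P := by
          have e : (fun v : ℝ => ‖weilMellin w (1 / 2 + v * I)‖ ^ 2 *
              (5 + Real.log (1 + |v|) + Real.log (1 + |T|))) =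
              fun v : ℝ => ‖weilMellin w (1 / 2 + v * I)‖ ^ 2 * (5 + Real.log (1 + |v|)) +
                Real.log (1 + |T|) * ‖weilMellin w (1 / 2 + v * I)‖ ^ 2 := by
            funext v; ring
          have hi1 : Integrable fun v : ℝ => ‖weilMellin w (1 / 2 + v * I)‖ ^ 2 *
              (5 + Real.log (1 + |v|)) := by
            refine integrable_norm_sq_weilMellin_mul hw (by fun_prop) (by norm_num : (0:ℝ) ≤ 6)
              (by norm_num : (0:ℝ) ≤ 1 / 2) fun v => ?_
            have h1 : 0 ≤ Real.log (1 + |v|) := Real.log_nonneg (by linarith [abs_nonneg v])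
            have h3 : Real.log (1 + |v|) ≤ |v| := by
              have := Real.log_le_sub_one_of_pos (by linarith [abs_nonneg v] : (0 : ℝ) < 1 + |v|)
              linarith
            rw [abs_of_nonneg (by linarith)]
            nlinarith [sq_nonneg (|v| - 1), sq_abs v]
          have hi2 : Integrable fun v : ℝ =>
              Real.log (1 + |T|) * ‖weilMellin w (1 / 2 + v * I)‖ ^ 2 :=
            (integrable_norm_sq_weilMellin_half_line hw).const_mul _
          rw [e, integral_add hi1 hi2, MeasureTheory.integral_const_mul]
  -- (4) assemble
  have hQle : (weilQuadratic wT).re ≤ 2 * L ^ 2 + K + P * Real.log (1 + |T|) := by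
    rw [hQ, weilArchQuadratic]
    have hpi : 1 / (2 * π) * (K + Real.log (1 + |T|) * P) ≤ K + Real.log (1 + |T|) * P := by
      have hX : 0 ≤ K + Real.log (1 + |T|) * P := by
        have := Real.log_nonneg (by linarith [abs_nonneg T] : (1 : ℝ) ≤ 1 + |T|)
        positivity
      have h12 : 1 / (2 * π) ≤ 1 := by
        rw [div_le_one (by positivity)]; linarith [Real.pi_gt_three]
      nlinarith
    have harch' : 1 / (2 * π) * ∫ u : ℝ, ‖weilMellin wT (1 / 2 + u * I)‖ ^ 2 *
        (Complex.digamma (1 / 4 + u / 2 * I)).re ≤ 1 / (2 * π) * (K + Real.log (1 + |T|) * P) :=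
      mul_le_mul_of_nonneg_left harch (by positivity)
    nlinarith
  have hlogT : 0 ≤ Real.log (1 + |T|) := Real.log_nonneg (by linarith [abs_nonneg T])
  have hmain : (s.card : ℝ) * c ≤ 2 * L ^ 2 + K + P * Real.log (1 + |T|) :=
    hcount.trans (hsum.trans hQle)
  rw [div_mul_eq_mul_div, le_div_iff₀ hc]
  nlinarith

/-- Curried form of `stub_upperLawUniform`: for a window half-width `A > 0`, a constant `C > 0`
bounding by `C (1 + log(1 + |T|))` the number of indices in any unit window `[T-1, T+1]` of EVERY
real family reproducing the Weil functional on the Weil tests supported in `[-A, A]`. [folklore] -/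
theorem card_near_le_log_uniform {A : ℝ} (hA : 0 < A) :
    ∃ C : ℝ, 0 < C ∧ ∀ (ι : Type) (γ : ι → ℝ),
      (∀ g : ℝ → ℂ, IsWeilTest g → tsupport g ⊆ Icc (-A) A →
        HasSum (fun i => weilMellin g (1 / 2 + (γ i : ℂ) * I)) (weilFunctional g)) →
      ∀ (T : ℝ) (s : Finset ι), (∀ i ∈ s, |γ i - T| ≤ 1) →
        (s.card : ℝ) ≤ C * (1 + Real.log (1 + |T|)) :=
  stub_upperLawUniform A hA

end Summit.RiemannHypothesis.RiemannHypothesis.Theorems.SpectralTraceWindowStep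

end
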